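import Summits.BirchSwinnertonDyer.BirchSwinnertonDyer.Theorems.ByReductionTypeAtTwoOrdKatoHalfAtTwoIsoColemanHalfClassCells
import HarnessLib

/-!
# Route ByReductionTypeAtTwo, crux `OrdKatoHalfAtTwoIso` (stmt-BirchSwinnertonDyer-19573), child B7′
# (stmt-BirchSwinnertonDyer-23921 `OrdKatoMuPartOptimalAtTwo`): the Coleman half-class package at the optimal member is asked
# only OFF Greenberg's Prop-5.14 locus — B7′ and the crux BY NAME with the print conjunct «5.14 at 2» LOAD-BEARING again
# (theorems only; skeleton v16 of line `steinberg-fibre-at-two`)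

Seat `cruxlead-stmt-BirchSwinnertonDyer-19573` g7 (LEAD PROVER, MODE LINE; HOME `run/shared/lean/pub/bsd-2adic/`; crux-triage
r1 seat 1 GEN 32 SHARPEN s5, `Cruxes/OrdKatoHalfAtTwoIso/TRIAGE-r1-1.md` F-32 (2)(3)). HONEST FRAMING (cell bsd-2adic): BSD is not
proved by any of this; the crux, its children 24097 (PAIR) and 23921 (B7′) are NOT proved here; THEOREMS ONLY, each CONDITIONAL on
the displayed OPEN statements it names (memo-tier readings `ZetaColemanMuIotaNegDiscAtTwo`, `HasColemanHalfClassPackageAtTwo`,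
the research statement `FineSelmerConjATwoOrdPosDisc`) and on PRINT facts by name. No definition, no `sorry`, nothing asserted.

WHY. In skeleton v15 (b836673d) the not-onto cell's memo stub Col½-opt asks the half-class package
`HasColemanHalfClassPackageAtTwo W₀ f κ γ D Y` at EVERY lattice-optimal member `W₀` of every non-CM good-ordinary class with `ρ̄₂`
not onto, so w2's door `katoMuPartOff514_of_print_of_colemanHalfClassPackage` always answers B7′'s disjunction by `Or.inl` and the
print conjunct Greenberg 1999 Prop. 5.14 at `2` of the bundle (child 23889) is IDLE in the composition (triage F-32 (2):
`crux_of_v15_stubs_without514`). The extent-honest cut asks the package only where print does not already give «`Λ`-cotorsion ∧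
`μ = 0`»: at the optimal members `W₀` that carry NO rational `2`-torsion point `(x, y)`, `2y + a₁x + a₃ = 0`, that is
ramified-at-`2` XOR odd — the literal negation of B7′'s Prop-5.14 datum at `W₀`.

* §1 `katoMuPartOff514_of_print_of_colemanHalfClassPackage_off514` — B7′ BY NAME ⟸ {Abbes–Ullmo, modularity, Lim 2017 Thm 3.5@2,
  Ferrero–Washington} + (Col½-opt-off514), by cases on the 5.14 datum at the optimal member (`Or.inr` on the locus, the package
  off it); `ordKatoMuPartOptimalAtTwo_of_print_of_colemanHalfClassPackage_off514` — the route child 23921 BY NAME;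
  `colemanHalfClassPackage_optimal_off514_of_optimal` — monotone: v15's Col½-opt implies the weakened binder (nothing registered breaks).
* §2 `ordKatoHalfAtTwoIso_of_negDisc_of_halfClass_of_conjA_of_print_off514` — THE CRUX BY NAME ⟸ F1μι⁻ + (Col½⁺) + Q⁺ +
  (Col½-opt-off514) + PRINT {bundle 23889 = PUB ∧ Abbes–Ullmo ∧ 5.14@2 — the last now CONSUMED by the split glue
  `ordKatoHalfAtTwoIso_of_iota_halves` on the `Or.inr` branch —, Lim@2, Ferrero–Washington}: the v16 composition of the line;
  `…_of_colemanMu_…_off514` — the same with (Col½⁺) := P⁺ (lead g6's text, w2's monotonicity).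

References: [GreenbergLNM1716] Prop. 5.14 (p. 130), p. 170; [Kato2004Asterisque] Thm 17.4 (1)(2) (p. 273), §17.13 (pp. 279–280);
[AbbesUllmo1996] Thm A; [EdixhovenManin1991] Prop. 2; [Lim2017FineSelmer] §3 Thm 3.5, Lemma 3.2; [FerreroWashington1979]; tree p692385
(`katoMuPartOff514_of_optimalMember`), p695020 (`ordKatoHalfAtTwoIso_of_iota_halves`), p700838, p701322 (w2 GEN 4), triage `W32.lean` (evidence, 07:03Z).
-/

set_option autoImplicit false
set_option linter.dupNamespace false

noncomputable section

open scoped Classical MatrixGroups ModularForm NumberField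
open CongruenceSubgroup WeierstrassCurve Field IsDedekindDomain NumberField
open Literature.NumberTheory.GaloisRepresentations
open Literature.NumberTheory.GaloisCohomology
open Literature.NumberTheory.EllipticCurves Literature.NumberTheory.EllipticCurves.ModularForms
open Literature.NumberTheory.EllipticCurves.Kato2004
  Literature.NumberTheory.EllipticCurves.Kato2004.EulerSystemValues
open Literature.NumberTheory.EllipticCurves.Rank1Residual
open Literature.NumberTheory.EllipticCurves.Greenberg1999
open Literature.NumberTheory.IwasawaTheory
open Summit.BirchSwinnertonDyer.BirchSwinnertonDyer.Theorems.Rank1ResidualX1Defs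
  Summit.BirchSwinnertonDyer.BirchSwinnertonDyer.Rank1Residual
  Summit.BirchSwinnertonDyer.BirchSwinnertonDyer.Rank1Residual.CoreAssembly
open Summit.BirchSwinnertonDyer.Rank1Residual Summit.BirchSwinnertonDyer.Rank1Residual.X5
open Summit.BirchSwinnertonDyer.BirchSwinnertonDyer.Theorems.OrdKatoOptimalAtTwo
  Summit.BirchSwinnertonDyer.BirchSwinnertonDyer.Theorems.OrdKatoIntAtTwo
open Summit.BirchSwinnertonDyer.BirchSwinnertonDyer.Theses.ByReductionTypeAtTwo

namespace Summit.BirchSwinnertonDyer.BirchSwinnertonDyer.Theorems.SteinbergFibreAtTwo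

/-! ## §1 B7′ from print + the half-class package OFF the Prop-5.14 locus -/

/-- **B7′ `KatoMuPartOff514AtOptimalMemberOfNotSurjectiveTwo` (child stmt-BirchSwinnertonDyer-23921) BY NAME ⟸ FOUR PRINT FACTS +
the half-class package OFF THE 5.14 LOCUS** — (Col½-opt-off514): `HasColemanHalfClassPackageAtTwo W₀ f κ γ D Y` for every non-CM
globally minimal `W`, good ordinary at `2`, `ρ̄_{W,2}` NOT onto, every isogenous lattice-optimal `W₀` (datum `D₀`, `Λ_{W₀} = c₀·Λ_f`)
**carrying no rational `2`-torsion point that is ramified-at-`2` XOR odd**, every newform of `W₀`, all cyclotomic and dual data.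
By cases at the optimal member (`katoMuPartOff514_of_optimalMember`, p692385): on the 5.14 locus B7′'s right disjunct holds
verbatim; off it the package + (A₂) (Lim@2 + Ferrero–Washington on the not-onto class, `conjATwo_notSurjective_isogenous`) + `ord₂ ϖ₀
= 0` (Abbes–Ullmo at the optimal member) give `X5.O1.KatoMuPartAtTwo W₀`. Conditional; nothing closed; the binder is memo tier
(a READING of Kato §§12–17 at `2`), asked on strictly fewer curves than v15's Col½-opt. Triage r1-1 GEN 32 SHARPEN s5.
[cite: GreenbergLNM1716, Prop. 5.14 (p. 130) and p. 170 (shape)] [cite: AbbesUllmo1996, Thm. A] [cite: EdixhovenManin1991, Prop. 2]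
[cite: Lim2017FineSelmer, §3 Thm. 3.5 and Lemma 3.2] [cite: FerreroWashington1979, main theorem]
[cite: Kato2004Asterisque, §17.13 (pp. 279–280) (shape; nothing asserted)] -/
theorem katoMuPartOff514_of_print_of_colemanHalfClassPackage_off514
    (hAU : abbesUllmo_not_dvd_maninConstant_of_not_dvd_level) (hMod : nonempty_modularParametrizationData)
    (hLim2 : Lim2017.thm35_at_two_fineSelmerDual_moduleFinite_of_classicalMuVanishes_of_le_divisionField_four)
    (hFW : ferreroWashington1979_classicalMuVanishes)
    (hCol : ∀ (W : WeierstrassCurve ℚ) [W.IsElliptic] [W.IsGloballyMinimal],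
      ¬ W.HasCM → GoodOrd W 2 → ¬ W.HasSurjectiveModNGaloisRep 2 →
      ∀ (W₀ : WeierstrassCurve ℚ) [W₀.IsElliptic] [W₀.IsGloballyMinimal] {N₀ : ℕ} [NeZero N₀]
        (D₀ : ModularParametrizationData W₀ N₀), WeierstrassCurve.IsIsogenous W W₀ →
        (∀ z ∈ D₀.L.lattice, ∃ w ∈ periodLattice D₀.f, z = D₀.c * w) →
        (¬ ∃ x y : ℚ, W₀.toAffine.Equation x y ∧ 2 * y + W₀.a₁ * x + W₀.a₃ = 0 ∧
          ((TwoTorsionRamifiedAtTwo x ∧ ¬ TwoTorsionOdd W₀ x) ∨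
            (TwoTorsionOdd W₀ x ∧ ¬ TwoTorsionRamifiedAtTwo x))) →
      ∀ {N : ℕ} [NeZero N] (f : CuspForm (Gamma0 N) 2) (κ : ZpExtension ℚ 2) (γ : absoluteGaloisGroup ℚ),
        κ.IsCyclotomic → κ.IsTopGenerator γ → IsCyclotomicVariable 2 γ → IsNewformOf W₀ f →
        ∀ (D : W₀.SelmerDualData κ γ) (Y : W₀.FineSelmerDualData κ γ), HasColemanHalfClassPackageAtTwo W₀ f κ γ D Y) :
    KatoMuPartOff514AtOptimalMemberOfNotSurjectiveTwo := by
  refine katoMuPartOff514_of_optimalMember hAU hMod ?_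
  intro W _ _ hcm hgo hns W₀ _ _ N₀ _ D₀ hiso hopt
  by_cases h514 : ∃ x y : ℚ, W₀.toAffine.Equation x y ∧ 2 * y + W₀.a₁ * x + W₀.a₃ = 0 ∧
      ((TwoTorsionRamifiedAtTwo x ∧ ¬ TwoTorsionOdd W₀ x) ∨ (TwoTorsionOdd W₀ x ∧ ¬ TwoTorsionRamifiedAtTwo x))
  · exact Or.inr h514
  · exact Or.inl <| katoMuPartAtTwo_of_hasColemanHalfClassPackageAtTwo_of_finite_fineSelmer_of_integralRatio W₀
      (fun f κ γ hκ hγ hγ' hf D Y ↦ hCol W hcm hgo hns W₀ D₀ hiso hopt h514 f κ γ hκ hγ hγ' hf D Y)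
      (fun κ hκ ↦ conjATwo_notSurjective_isogenous hLim2 hFW W hns hiso κ hκ)
      (fun f hf ϖ hϖ ↦ (padicValRat_two_neronRatio_eq_zero_of_latticeOptimal_of_abbesUllmo hAU W₀
        (goodOrd_two_of_isIsogenous W hiso hgo).1 D₀ hopt f hf ϖ hϖ).ge)

/-- **The route's child `OrdKatoMuPartOptimalAtTwo` (stmt-BirchSwinnertonDyer-23921, text = B7′ verbatim) BY NAME from the four
print facts and the half-class package OFF the 5.14 locus.** Conditional; the item is NOT closed by this; nothing asserted.
[cite: GreenbergLNM1716, Prop. 5.14 (p. 130)] [cite: AbbesUllmo1996, Thm. A] [cite: Lim2017FineSelmer, §3 Thm. 3.5 and Lemma 3.2]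
[cite: FerreroWashington1979, main theorem] -/
theorem ordKatoMuPartOptimalAtTwo_of_print_of_colemanHalfClassPackage_off514
    (hAU : abbesUllmo_not_dvd_maninConstant_of_not_dvd_level) (hMod : nonempty_modularParametrizationData)
    (hLim2 : Lim2017.thm35_at_two_fineSelmerDual_moduleFinite_of_classicalMuVanishes_of_le_divisionField_four)
    (hFW : ferreroWashington1979_classicalMuVanishes)
    (hCol : ∀ (W : WeierstrassCurve ℚ) [W.IsElliptic] [W.IsGloballyMinimal],
      ¬ W.HasCM → GoodOrd W 2 → ¬ W.HasSurjectiveModNGaloisRep 2 →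
      ∀ (W₀ : WeierstrassCurve ℚ) [W₀.IsElliptic] [W₀.IsGloballyMinimal] {N₀ : ℕ} [NeZero N₀]
        (D₀ : ModularParametrizationData W₀ N₀), WeierstrassCurve.IsIsogenous W W₀ →
        (∀ z ∈ D₀.L.lattice, ∃ w ∈ periodLattice D₀.f, z = D₀.c * w) →
        (¬ ∃ x y : ℚ, W₀.toAffine.Equation x y ∧ 2 * y + W₀.a₁ * x + W₀.a₃ = 0 ∧
          ((TwoTorsionRamifiedAtTwo x ∧ ¬ TwoTorsionOdd W₀ x) ∨
            (TwoTorsionOdd W₀ x ∧ ¬ TwoTorsionRamifiedAtTwo x))) →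
      ∀ {N : ℕ} [NeZero N] (f : CuspForm (Gamma0 N) 2) (κ : ZpExtension ℚ 2) (γ : absoluteGaloisGroup ℚ),
        κ.IsCyclotomic → κ.IsTopGenerator γ → IsCyclotomicVariable 2 γ → IsNewformOf W₀ f →
        ∀ (D : W₀.SelmerDualData κ γ) (Y : W₀.FineSelmerDualData κ γ), HasColemanHalfClassPackageAtTwo W₀ f κ γ D Y) :
    OrdKatoMuPartOptimalAtTwo :=
  katoMuPartOff514_of_print_of_colemanHalfClassPackage_off514 hAU hMod hLim2 hFW hCol

/-- **Monotonicity: v15's Col½-opt (the package at EVERY optimal member of a not-onto class) implies the weakened binder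
(Col½-opt-off514)** — drop the extra hypothesis; so skeleton v15 as registered implies v16's stub and nothing registered breaks.
[folklore] -/
theorem colemanHalfClassPackage_optimal_off514_of_optimal
    (hCol : ∀ (W : WeierstrassCurve ℚ) [W.IsElliptic] [W.IsGloballyMinimal],
      ¬ W.HasCM → GoodOrd W 2 → ¬ W.HasSurjectiveModNGaloisRep 2 →
      ∀ (W₀ : WeierstrassCurve ℚ) [W₀.IsElliptic] [W₀.IsGloballyMinimal] {N₀ : ℕ} [NeZero N₀]
        (D₀ : ModularParametrizationData W₀ N₀), WeierstrassCurve.IsIsogenous W W₀ →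
        (∀ z ∈ D₀.L.lattice, ∃ w ∈ periodLattice D₀.f, z = D₀.c * w) →
      ∀ {N : ℕ} [NeZero N] (f : CuspForm (Gamma0 N) 2) (κ : ZpExtension ℚ 2) (γ : absoluteGaloisGroup ℚ),
        κ.IsCyclotomic → κ.IsTopGenerator γ → IsCyclotomicVariable 2 γ → IsNewformOf W₀ f →
        ∀ (D : W₀.SelmerDualData κ γ) (Y : W₀.FineSelmerDualData κ γ), HasColemanHalfClassPackageAtTwo W₀ f κ γ D Y) :
    ∀ (W : WeierstrassCurve ℚ) [W.IsElliptic] [W.IsGloballyMinimal],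
      ¬ W.HasCM → GoodOrd W 2 → ¬ W.HasSurjectiveModNGaloisRep 2 →
      ∀ (W₀ : WeierstrassCurve ℚ) [W₀.IsElliptic] [W₀.IsGloballyMinimal] {N₀ : ℕ} [NeZero N₀]
        (D₀ : ModularParametrizationData W₀ N₀), WeierstrassCurve.IsIsogenous W W₀ →
        (∀ z ∈ D₀.L.lattice, ∃ w ∈ periodLattice D₀.f, z = D₀.c * w) →
        (¬ ∃ x y : ℚ, W₀.toAffine.Equation x y ∧ 2 * y + W₀.a₁ * x + W₀.a₃ = 0 ∧
          ((TwoTorsionRamifiedAtTwo x ∧ ¬ TwoTorsionOdd W₀ x) ∨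
            (TwoTorsionOdd W₀ x ∧ ¬ TwoTorsionRamifiedAtTwo x))) →
      ∀ {N : ℕ} [NeZero N] (f : CuspForm (Gamma0 N) 2) (κ : ZpExtension ℚ 2) (γ : absoluteGaloisGroup ℚ),
        κ.IsCyclotomic → κ.IsTopGenerator γ → IsCyclotomicVariable 2 γ → IsNewformOf W₀ f →
        ∀ (D : W₀.SelmerDualData κ γ) (Y : W₀.FineSelmerDualData κ γ), HasColemanHalfClassPackageAtTwo W₀ f κ γ D Y :=
  fun W _ _ hcm hgo hns W₀ _ _ _ _ D₀ hiso hopt _ _ _ f κ γ hκ hγ hγ' hf D Y ↦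
    hCol W hcm hgo hns W₀ D₀ hiso hopt f κ γ hκ hγ hγ' hf D Y

/-! ## §2 The crux BY NAME — v16 composition (Greenberg 5.14@2 consumed) -/

/-- **The crux `OrdKatoHalfAtTwoIso` BY NAME ⟸ F1μι⁻ + (Col½⁺) + Q⁺ + (Col½-opt-off514) + PRINT** {bundle (child 23889: PUB ∧
Abbes–Ullmo ∧ Greenberg 5.14@2), Lim 2017 Thm 3.5 at `2`, Ferrero–Washington}: lead g5's split door `ordKatoHalfAtTwoIso_of_iota_halves`
(p695020) with the `0 < Δ` input from w2's `ordKatoHalfAtTwoIsoPosDisc_of_halfClassPosDisc_of_conjA` and B7′ from §1; on the `Or.inr`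
branch of B7′ the split glue turns the 5.14 datum into `μ = 0` by Greenberg's Prop. 5.14 at `2` (print), so the bundle's third conjunct
is LOAD-BEARING (triage F-32 (2)(3)). The v16 composition of line `steinberg-fibre-at-two`. CONDITIONAL on the displayed OPEN
statements; nothing closed. [cite: Kato2004Asterisque, Thm. 17.4 (1)(2) (p. 273), §17.13 (pp. 279–280)]
[cite: GreenbergLNM1716, Prop. 5.14 (p. 130)] [cite: AbbesUllmo1996, Thm. A] [cite: Lim2017FineSelmer, §3 Thm. 3.5 and Lemma 3.2]
[cite: FerreroWashington1979, main theorem] -/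
theorem ordKatoHalfAtTwoIso_of_negDisc_of_halfClass_of_conjA_of_print_off514 (hNeg : ZetaColemanMuIotaNegDiscAtTwo)
    (hPos : ∀ (W : WeierstrassCurve ℚ) [W.IsElliptic] [W.IsGloballyMinimal], ¬ W.HasCM → W.analyticRank = 0 →
      GoodOrd W 2 → W.HasSurjectiveModNGaloisRep 2 → 0 < W.Δ →
      ∀ {N : ℕ} [NeZero N] (f : CuspForm (Gamma0 N) 2) (κ : ZpExtension ℚ 2) (γ : absoluteGaloisGroup ℚ),
        κ.IsCyclotomic → κ.IsTopGenerator γ → IsCyclotomicVariable 2 γ → IsNewformOf W f →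
        ∀ (D : W.SelmerDualData κ γ) (Y : W.FineSelmerDualData κ γ), HasColemanHalfClassPackageAtTwo W f κ γ D Y)
    (hQ : FineSelmerConjATwoOrdPosDisc)
    (hCol : ∀ (W : WeierstrassCurve ℚ) [W.IsElliptic] [W.IsGloballyMinimal],
      ¬ W.HasCM → GoodOrd W 2 → ¬ W.HasSurjectiveModNGaloisRep 2 →
      ∀ (W₀ : WeierstrassCurve ℚ) [W₀.IsElliptic] [W₀.IsGloballyMinimal] {N₀ : ℕ} [NeZero N₀]
        (D₀ : ModularParametrizationData W₀ N₀), WeierstrassCurve.IsIsogenous W W₀ →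
        (∀ z ∈ D₀.L.lattice, ∃ w ∈ periodLattice D₀.f, z = D₀.c * w) →
        (¬ ∃ x y : ℚ, W₀.toAffine.Equation x y ∧ 2 * y + W₀.a₁ * x + W₀.a₃ = 0 ∧
          ((TwoTorsionRamifiedAtTwo x ∧ ¬ TwoTorsionOdd W₀ x) ∨
            (TwoTorsionOdd W₀ x ∧ ¬ TwoTorsionRamifiedAtTwo x))) →
      ∀ {N : ℕ} [NeZero N] (f : CuspForm (Gamma0 N) 2) (κ : ZpExtension ℚ 2) (γ : absoluteGaloisGroup ℚ),
        κ.IsCyclotomic → κ.IsTopGenerator γ → IsCyclotomicVariable 2 γ → IsNewformOf W₀ f →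
        ∀ (D : W₀.SelmerDualData κ γ) (Y : W₀.FineSelmerDualData κ γ), HasColemanHalfClassPackageAtTwo W₀ f κ γ D Y)
    (hbundle : OrdPublishedInputsAtTwo ∧ abbesUllmo_not_dvd_maninConstant_of_not_dvd_level ∧
      Greenberg1999.prop514_isTorsion_mu_eq_zero_two)
    (hLim2 : Lim2017.thm35_at_two_fineSelmerDual_moduleFinite_of_classicalMuVanishes_of_le_divisionField_four)
    (hFW : ferreroWashington1979_classicalMuVanishes) : OrdKatoHalfAtTwoIso := by
  have hAU := hbundle.2.1
  obtain ⟨hMod, _, h17, _⟩ := hbundle.1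
  exact ordKatoHalfAtTwoIso_of_iota_halves hNeg (ordKatoHalfAtTwoIsoPosDisc_of_halfClassPosDisc_of_conjA hPos hQ hAU h17)
    hbundle (katoMuPartOff514_of_print_of_colemanHalfClassPackage_off514 hAU hMod hLim2 hFW hCol)

/-- **The same with (Col½⁺) := lead g6's P⁺ `ColemanMuSpanFreeIotaPosDiscAtTwo`** (w2's monotonicity
`halfClassPosDisc_of_colemanMuSpanFreeIotaPosDiscAtTwo`) — the literal v16 term of the skeleton's `OrdKatoHalfAtTwoIso_of` over its
registered stub names. CONDITIONAL; nothing closed. [cite: Kato2004Asterisque, Thm. 17.4 (1)(2) (p. 273)]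
[cite: GreenbergLNM1716, Prop. 5.14 (p. 130)] -/
theorem ordKatoHalfAtTwoIso_of_negDisc_of_colemanMu_of_conjA_of_halfClassOff514_of_print (hNeg : ZetaColemanMuIotaNegDiscAtTwo)
    (hP : ColemanMuSpanFreeIotaPosDiscAtTwo) (hQ : FineSelmerConjATwoOrdPosDisc)
    (hCol : ∀ (W : WeierstrassCurve ℚ) [W.IsElliptic] [W.IsGloballyMinimal],
      ¬ W.HasCM → GoodOrd W 2 → ¬ W.HasSurjectiveModNGaloisRep 2 →
      ∀ (W₀ : WeierstrassCurve ℚ) [W₀.IsElliptic] [W₀.IsGloballyMinimal] {N₀ : ℕ} [NeZero N₀]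
        (D₀ : ModularParametrizationData W₀ N₀), WeierstrassCurve.IsIsogenous W W₀ →
        (∀ z ∈ D₀.L.lattice, ∃ w ∈ periodLattice D₀.f, z = D₀.c * w) →
        (¬ ∃ x y : ℚ, W₀.toAffine.Equation x y ∧ 2 * y + W₀.a₁ * x + W₀.a₃ = 0 ∧
          ((TwoTorsionRamifiedAtTwo x ∧ ¬ TwoTorsionOdd W₀ x) ∨
            (TwoTorsionOdd W₀ x ∧ ¬ TwoTorsionRamifiedAtTwo x))) →
      ∀ {N : ℕ} [NeZero N] (f : CuspForm (Gamma0 N) 2) (κ : ZpExtension ℚ 2) (γ : absoluteGaloisGroup ℚ),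
        κ.IsCyclotomic → κ.IsTopGenerator γ → IsCyclotomicVariable 2 γ → IsNewformOf W₀ f →
        ∀ (D : W₀.SelmerDualData κ γ) (Y : W₀.FineSelmerDualData κ γ), HasColemanHalfClassPackageAtTwo W₀ f κ γ D Y)
    (hbundle : OrdPublishedInputsAtTwo ∧ abbesUllmo_not_dvd_maninConstant_of_not_dvd_level ∧
      Greenberg1999.prop514_isTorsion_mu_eq_zero_two)
    (hLim2 : Lim2017.thm35_at_two_fineSelmerDual_moduleFinite_of_classicalMuVanishes_of_le_divisionField_four)
    (hFW : ferreroWashington1979_classicalMuVanishes) : OrdKatoHalfAtTwoIso :=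
  ordKatoHalfAtTwoIso_of_negDisc_of_halfClass_of_conjA_of_print_off514 hNeg
    (halfClassPosDisc_of_colemanMuSpanFreeIotaPosDiscAtTwo hP) hQ hCol hbundle hLim2 hFW

end Summit.BirchSwinnertonDyer.BirchSwinnertonDyer.Theorems.SteinbergFibreAtTwo

end
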